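import Summits.Ventures.PercRepro.Night2FatZOneD
import Summits.Ventures.PercRepro.Night2FatZLarge

/-!
# night-2: exactly one basis point on the spine (E) — the assembly, every `N`

**`basis_pair_fair_fat_of_two_planes_of_one_basis_point`**: a lossy basis pair of the non-degenerate two-planes regime with
exactly one basis point `a` on the spine (and `d` the only basis point of `π₃` off it) has its fair share for every `N`:
two points of `W ∖ {x}` in each plane off the spine (`…_seven`, `…_of_eight_le`) or a unique one in `π₂`
(`…_one_six` / `…_one_seven` / `…_one_eight_le`).  Paper `proofs/NIGHT-2-g34.md` §6 (b).
-/

namespace PercRepro.Shadow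

open PercRepro.ThmH PercRepro.PerFlat

variable {α : Type*} [DecidableEq α] {M : Matroid α} [M.Finite] {G : Finset α}

/-- **Exactly one basis point on the spine: the fair share for every `N`** (non-degenerate two-planes regime; `a` the
basis point on the spine, `d` the only basis point of `π₃` off it). -/
theorem basis_pair_fair_fat_of_two_planes_of_one_basis_point (hG : G ∈ flatsQ M (5 + 1))
    (hd : (gr M \ G).card = 2) (hk : kColoops M G = 1)
    (hs : ∀ e ∈ gr M, ∀ f ∈ gr M, e ≠ f → rkN M {e, f} = 2) (hl : ∀ e ∈ gr M, M.Indep {e})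
    (hfat : (fatClosures M 5 G 2).card ≤ 1)
    {B₀ : Finset α} (hB₀ : B₀ ∈ thinMembers M 5 G) {w₀ x : α} (hD : G \ clF M B₀ = {w₀, x}) (hne : w₀ ≠ x) {R₁ : Finset α}
    (hR₁V : R₁ ⊆ (G \ coloops M G) \ {w₀, x}) (hR₁2 : rkN M R₁ = 2) (hR₁3 : 3 ≤ R₁.card) {c₂ c₃ : α}
    (hc₂V : c₂ ∈ (G \ coloops M G) \ {w₀, x}) (hc₃V : c₃ ∈ (G \ coloops M G) \ {w₀, x})
    (hc₂ : c₂ ∉ clF M R₁) (hc₃ : c₃ ∉ clF M (insert c₂ R₁))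
    (hcover : ∀ e ∈ (G \ coloops M G) \ {w₀, x}, e ∈ clF M (insert c₂ R₁) ∨ e ∈ clF M (insert c₃ R₁))
    (hnd₂ : 3 ≤ rkN M (((G \ coloops M G) \ {w₀, x}).filter
      (fun e => e ∈ clF M (insert c₂ R₁) ∧ e ∉ clF M R₁)))
    (hnd₃ : 3 ≤ rkN M (((G \ coloops M G) \ {w₀, x}).filter
      (fun e => e ∈ clF M (insert c₃ R₁) ∧ e ∉ clF M R₁)))
    {B : Finset α} (hB : B ∈ thinMembers M 5 G) (hnP : ¬ bigP M G B) {z : α} (hz : z ∈ G \ clF M B)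
    (hl0 : loss M 5 G B z ≠ 0) (hw₀ : w₀ ∈ insert z B) (hx : x ∉ insert z B) {a d : α}
    (haP : a ∈ (insert z B \ coloops M G).erase w₀) (haL : a ∈ clF M R₁)
    (hP₀a : ∀ e ∈ insert z B \ coloops M G, e ∈ clF M R₁ → e = a)
    (hdP : d ∈ (insert z B \ coloops M G).erase w₀) (hdL : d ∉ clF M R₁)
    (hP₀d : ∀ e ∈ insert z B \ coloops M G, e ∈ clF M (insert c₃ R₁) → e ∉ clF M R₁ → e = d) :
    loss M 5 G B z ≤ rhoL M 5 G B z * lossIncomeH M 5 G (bigP M G) (dshGT2 M 5 G) B z := by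
  have hd' : (gr M \ G).card ≤ 5 := by omega
  have hGg : G ⊆ gr M := (mem_flatsQ.1 hG).1
  have hQG : insert z B ⊆ G :=
    Finset.insert_subset (Finset.mem_sdiff.1 hz).1 (subset_G_of_mem_thinMembers hB)
  have hKQ : coloops M G ⊆ insert z B :=
    (coloops_subset_of_mem_thinMembers hG hd' hB).trans (Finset.subset_insert _ _)
  have hxG : x ∈ G \ insert z B := by
    refine Finset.mem_sdiff.2 ⟨?_, hx⟩
    have : x ∈ G \ clF M B₀ := by
      rw [hD]
      exact Finset.mem_insert_of_mem (Finset.mem_singleton_self _)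
    exact (Finset.mem_sdiff.1 this).1
  have hVg : (G \ coloops M G) \ {w₀, x} ⊆ gr M := fun e he =>
    hGg (Finset.mem_sdiff.1 (Finset.mem_sdiff.1 he).1).1
  have hR₁g : R₁ ⊆ gr M := hR₁V.trans hVg
  have hc₂g : c₂ ∈ gr M := hVg hc₂V
  have hc₃g : c₃ ∈ gr M := hVg hc₃V
  set W' := (G \ insert z B).erase x with hW'
  set P₀ := (insert z B \ coloops M G).erase w₀ with hP₀
  set V' := (G \ coloops M G) \ {w₀, x} with hV'
  have hW'V : W' ⊆ V' := by
    intro e he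
    rw [hW', Finset.mem_erase, Finset.mem_sdiff] at he
    rw [hV', Finset.mem_sdiff, Finset.mem_sdiff, Finset.mem_insert, Finset.mem_singleton]
    refine ⟨⟨he.2.1, fun h' => he.2.2 (hKQ h')⟩, ?_⟩
    rintro (rfl | rfl)
    · exact he.2.2 hw₀
    · exact he.1 rfl
  have hP₀V : P₀ ⊆ V' := by
    intro e he
    rw [hP₀, Finset.mem_erase, Finset.mem_sdiff] at he
    rw [hV', Finset.mem_sdiff, Finset.mem_sdiff, Finset.mem_insert, Finset.mem_singleton]
    refine ⟨⟨hQG he.2.1, he.2.2⟩, ?_⟩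
    rintro (rfl | rfl)
    · exact he.1 rfl
    · exact hx he.2.1
  have hVW : ∀ e ∈ V', e ∈ W' ∨ e ∈ P₀ := by
    intro e he
    rw [hV', Finset.mem_sdiff, Finset.mem_sdiff, Finset.mem_insert, Finset.mem_singleton, not_or] at he
    by_cases heQ : e ∈ insert z B
    · right
      rw [hP₀, Finset.mem_erase, Finset.mem_sdiff]
      exact ⟨he.2.1, heQ, he.1.2⟩
    · left
      rw [hW', Finset.mem_erase, Finset.mem_sdiff]
      exact ⟨he.2.2, he.1.1, heQ⟩
  have hWP : Disjoint W' P₀ := by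
    rw [Finset.disjoint_left]
    intro e he₁ he₂
    rw [hW', Finset.mem_erase, Finset.mem_sdiff] at he₁
    rw [hP₀, Finset.mem_erase, Finset.mem_sdiff] at he₂
    exact he₁.2.2 he₂.2.1
  have hQ5 := card_insert_sdiff_eq_five hG hd hk hB hnP hz
  have hrk5 := rkN_insert_sdiff_coloops_eq_five_of_thin hG hd hk hB hz
  have hind : M.Indep ((insert z B \ coloops M G : Finset α) : Set α) :=
    indep_of_rkN_eq_card (by rw [hrk5, hQ5])
  have hP₀ind : M.Indep (P₀ : Set α) := hind.subset (by exact_mod_cast (Finset.erase_subset _ _))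
  have hindep_card : ∀ S : Finset α, S ⊆ P₀ → ∀ X : Finset α, S ⊆ clF M X → S.card ≤ rkN M X := by
    intro S hS X hSX
    have := rkN_mono (M := M) hSX
    rw [rkN_clF, rkN_eq_card_of_indep (hP₀ind.subset (by exact_mod_cast hS))] at this
    exact this
  -- at most two basis points in `π₂` off the spine
  have hP₀2 : (P₀.filter (fun e => e ∈ clF M (insert c₂ R₁) ∧ e ∉ clF M R₁)).card ≤ 2 := by
    have hrk : rkN M (insert c₂ R₁) = 3 := by rw [rkN_insert_of_notMem_clF hc₂g hc₂, hR₁2]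
    have hsub : insert a (P₀.filter (fun e => e ∈ clF M (insert c₂ R₁) ∧ e ∉ clF M R₁)) ⊆ P₀ :=
      Finset.insert_subset haP (Finset.filter_subset _ _)
    have hsubc : insert a (P₀.filter (fun e => e ∈ clF M (insert c₂ R₁) ∧ e ∉ clF M R₁)) ⊆
        clF M (insert c₂ R₁) := by
      intro e he
      rw [Finset.mem_insert] at he
      rcases he with rfl | he
      · exact clF_mono (Finset.subset_insert _ _) haL
      · exact (Finset.mem_filter.1 he).2.1
    have h := hindep_card _ hsub _ hsubc
    rw [hrk, Finset.card_insert_of_notMem (fun h' => (Finset.mem_filter.1 h').2.2 haL)] at h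
    omega
  -- exactly one basis point in `π₃` off the spine
  have hP₀3 : (P₀.filter (fun e => e ∈ clF M (insert c₃ R₁) ∧ e ∉ clF M R₁)).card ≤ 1 := by
    rw [Finset.card_le_one]
    intro u hu v hv
    rw [Finset.mem_filter] at hu hv
    rw [hP₀d u (Finset.mem_of_mem_erase hu.1) hu.2.1 hu.2.2, hP₀d v (Finset.mem_of_mem_erase hv.1) hv.2.1 hv.2.2]
  -- the points of `W ∖ {x}` in the planes off the spine
  have hcount : ∀ c : α, c ∈ V' → c ∉ clF M R₁ →
      3 ≤ rkN M (V'.filter (fun e => e ∈ clF M (insert c R₁) ∧ e ∉ clF M R₁)) →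
      3 ≤ (W'.filter (fun e => e ∈ clF M (insert c R₁) ∧ e ∉ clF M R₁)).card +
        (P₀.filter (fun e => e ∈ clF M (insert c R₁) ∧ e ∉ clF M R₁)).card := by
    intro c hcV hcL hrk
    have h3 : 3 ≤ (V'.filter (fun e => e ∈ clF M (insert c R₁) ∧ e ∉ clF M R₁)).card :=
      le_trans hrk (rkN_le_card _)
    have hsplit : V'.filter (fun e => e ∈ clF M (insert c R₁) ∧ e ∉ clF M R₁) ⊆
        W'.filter (fun e => e ∈ clF M (insert c R₁) ∧ e ∉ clF M R₁) ∪
        P₀.filter (fun e => e ∈ clF M (insert c R₁) ∧ e ∉ clF M R₁) := by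
      intro e he
      rw [Finset.mem_filter] at he
      rw [Finset.mem_union, Finset.mem_filter, Finset.mem_filter]
      rcases hVW e he.1 with h | h
      · exact Or.inl ⟨h, he.2⟩
      · exact Or.inr ⟨h, he.2⟩
    have h1 := Finset.card_le_card hsplit
    have h2 := Finset.card_union_le (W'.filter (fun e => e ∈ clF M (insert c R₁) ∧ e ∉ clF M R₁))
      (P₀.filter (fun e => e ∈ clF M (insert c R₁) ∧ e ∉ clF M R₁))
    omega
  set A := W'.filter (fun e => e ∈ clF M (insert c₂ R₁) ∧ e ∉ clF M R₁) with hA'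
  set Bp := W'.filter (fun e => e ∈ clF M (insert c₃ R₁) ∧ e ∉ clF M R₁) with hBp'
  have hA : 1 ≤ A.card := by
    have := hcount c₂ hc₂V hc₂ hnd₂
    rw [← hA'] at this
    omega
  have hBp : 2 ≤ Bp.card := by
    have := hcount c₃ hc₃V (fun h' => hc₃ (clF_mono (Finset.subset_insert _ _) h')) hnd₃
    rw [← hBp'] at this
    omega
  -- the spine points of `W ∖ {x}`: at least two
  set TL := W'.filter (fun e => e ∈ clF M R₁) with hTL
  have hLcard : (V'.filter (fun e => e ∈ clF M R₁)).card = TL.card + 1 := by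
    have heq : V'.filter (fun e => e ∈ clF M R₁) = insert a TL := by
      ext e
      rw [Finset.mem_filter, Finset.mem_insert, hTL, Finset.mem_filter]
      constructor
      · rintro ⟨heV, heL⟩
        rcases hVW e heV with h | h
        · exact Or.inr ⟨h, heL⟩
        · exact Or.inl (hP₀a e (Finset.mem_of_mem_erase h) heL)
      · rintro (rfl | ⟨heW, heL⟩)
        · exact ⟨hP₀V haP, haL⟩
        · exact ⟨hW'V heW, heL⟩
    have haTL : a ∉ TL := by
      rw [hTL, Finset.mem_filter]
      rintro ⟨haW, -⟩
      exact Finset.disjoint_left.1 hWP haW haP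
    rw [heq, Finset.card_insert_of_notMem haTL]
  have hTL2 : 2 ≤ TL.card := by
    have hR₁sub : R₁ ⊆ V'.filter (fun e => e ∈ clF M R₁) :=
      fun e he => Finset.mem_filter.2 ⟨hR₁V he, subset_clF_of_subset_gr hR₁g he⟩
    have := Finset.card_le_card hR₁sub
    omega
  have hWcard : W'.card = TL.card + A.card + Bp.card := by
    have heq : W' = TL ∪ (A ∪ Bp) := by
      ext e
      rw [Finset.mem_union, Finset.mem_union, hTL, hA', hBp', Finset.mem_filter, Finset.mem_filter,
        Finset.mem_filter]
      constructor
      · intro he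
        by_cases heL : e ∈ clF M R₁
        · exact Or.inl ⟨he, heL⟩
        · rcases hcover e (hW'V he) with h | h
          · exact Or.inr (Or.inl ⟨he, h, heL⟩)
          · exact Or.inr (Or.inr ⟨he, h, heL⟩)
      · rintro (h | h | h) <;> exact h.1
    have hd1 : Disjoint TL (A ∪ Bp) := by
      rw [Finset.disjoint_left]
      intro e he₁ he₂
      rw [hTL, Finset.mem_filter] at he₁
      rw [Finset.mem_union, hA', hBp', Finset.mem_filter, Finset.mem_filter] at he₂
      rcases he₂ with h | h <;> exact h.2.2 he₁.2
    have hd2 : Disjoint A Bp := by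
      rw [Finset.disjoint_left]
      intro e he₁ he₂
      rw [hA', Finset.mem_filter] at he₁
      rw [hBp', Finset.mem_filter] at he₂
      exact he₁.2.2 (mem_clF_of_mem_two_planes hR₁g hc₂g hc₃g hc₂ hc₃ he₁.2.1 he₂.2.1)
    rw [heq, Finset.card_union_of_disjoint hd1, Finset.card_union_of_disjoint hd2]
    omega
  have hm : W'.card + 1 = (G \ insert z B).card := by
    rw [hW', Finset.card_erase_of_mem hxG]
    have : 0 < (G \ insert z B).card := Finset.card_pos.2 ⟨x, hxG⟩
    omega
  obtain ⟨y₃, y₃', hy₃, hy₃', hy₃y₃'⟩ := Finset.one_lt_card_iff.1 (by omega : 1 < Bp.card)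
  rw [hBp', Finset.mem_filter] at hy₃ hy₃'
  rcases Nat.lt_or_ge A.card 2 with hA1 | hA2
  · -- a unique point `y₂` of `W ∖ {x}` in `π₂` off the spine
    have hAc : A.card = 1 := by omega
    obtain ⟨y₂, hy₂A⟩ := Finset.card_eq_one.1 hAc
    have hy₂ : y₂ ∈ A := by rw [hy₂A]; exact Finset.mem_singleton_self _
    have hA1' : ∀ u ∈ (G \ insert z B).erase x, u ∈ clF M (insert c₂ R₁) → u ∉ clF M R₁ → u = y₂ := by
      intro u hu hu2 huL
      have : u ∈ A := by rw [hA', Finset.mem_filter]; exact ⟨hu, hu2, huL⟩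
      rw [hy₂A, Finset.mem_singleton] at this
      exact this
    rw [hA', Finset.mem_filter] at hy₂
    rcases Nat.lt_or_ge (G \ insert z B).card 7 with h7 | h7
    · have hN : (G \ insert z B).card = 6 := by omega
      have hL3 : (V'.filter (fun e => e ∈ clF M R₁)).card ≤ 3 := by omega
      obtain ⟨s, s', hsT, hs'T, hss'⟩ := Finset.one_lt_card_iff.1 (by omega : 1 < TL.card)
      rw [hTL, Finset.mem_filter] at hsT hs'T
      exact basis_pair_fair_fat_of_two_planes_one_six hG hd hk hs hl hfat hB₀ hD hne hR₁V hR₁2 hR₁3 hc₂V hc₃V hc₂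
        hc₃ hcover hnd₂ hnd₃ hL3 hB hnP hz hl0 hw₀ hx hN haP haL hP₀a hdP hdL hP₀d hy₂.1 hy₂.2.1 hy₂.2.2 hsT.1
        hsT.2 hs'T.1 hs'T.2 hss' hy₃.1 hy₃.2.1 hy₃.2.2 hy₃'.1 hy₃'.2.1 hy₃'.2.2 hy₃y₃'
    rcases Nat.lt_or_ge (G \ insert z B).card 8 with h8 | h8
    · have hN : (G \ insert z B).card = 7 := by omega
      have hL4 : (V'.filter (fun e => e ∈ clF M R₁)).card ≤ 4 := by omega
      exact basis_pair_fair_fat_of_two_planes_one_seven hG hd hk hs hl hfat hB₀ hD hne hR₁V hR₁2 hR₁3 hc₂V hc₃V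
        hc₂ hc₃ hcover hnd₂ hnd₃ hL4 hB hnP hz hl0 hw₀ hx hN hP₀a hy₂.1 hy₂.2.1 hy₂.2.2 hA1'
    · exact basis_pair_fair_fat_of_two_planes_one_eight_le hG hd hk hs hl hfat hB₀ hD hne hR₁V hR₁2 hR₁3 hc₂V hc₃V
        hc₂ hc₃ hcover hnd₂ hnd₃ hB hnP hz hl0 hw₀ hx h8 hP₀a hy₂.1 hy₂.2.1 hy₂.2.2 hA1'
  · -- two points in each plane off the spine
    obtain ⟨y₂, y₂', hy₂, hy₂', hy₂y₂'⟩ := Finset.one_lt_card_iff.1 (by omega : 1 < A.card)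
    rw [hA', Finset.mem_filter] at hy₂ hy₂'
    rcases Nat.lt_or_ge (G \ insert z B).card 8 with h8 | h8
    · have hN : (G \ insert z B).card = 7 := by omega
      have hL4 : (V'.filter (fun e => e ∈ clF M R₁)).card ≤ 4 := by omega
      exact basis_pair_fair_fat_of_two_planes_seven hG hd hk hs hl hfat hB₀ hD hne hR₁V hR₁2 hR₁3 hc₂V hc₃V hc₂ hc₃
        hcover hnd₂ hnd₃ hL4 hB hnP hz hl0 hw₀ hx hN (by simp only [← hW', ← hA']; omega)
        (by simp only [← hW', ← hBp']; omega) (by simp only [← hW', ← hA', ← hBp']; omega)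
    · exact basis_pair_fair_fat_of_two_planes_of_eight_le hG hd hk hs hl hfat hB₀ hD hne hR₁V hR₁2 hR₁3 hc₂V hc₃V
        hc₂ hc₃ hcover hnd₂ hnd₃ hB hnP hz hl0 hw₀ hx h8 hy₂.1 hy₂'.1 hy₃.1 hy₃'.1 hy₂y₂' hy₃y₃' hy₂.2.1 hy₂.2.2
        hy₂'.2.1 hy₂'.2.2 hy₃.2.1 hy₃.2.2 hy₃'.2.1 hy₃'.2.2

end PercRepro.Shadow
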